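import Summits.CriticalPhenomena.CardyFormulaZ2.Theorems.CardyFlipRussoSquareFromVoronoiHubDecimationAssembly
import HarnessLib

/-!
# Vocabulary of the line `SketchIdeator5R2` (card `one-product-leg`) for crux `SquareFromVoronoiHub`
# (stmt-CriticalPhenomena-6434, route `CardyFlipRusso`, sub-problem `CardyFormulaZ2`)

DEFINITIONS MODULE of the line (lead `prover-line-stmt-CriticalPhenomena-6434-a1-0`, 2026-08-17): the
objects that the line skeleton `Cruxes/SquareFromVoronoiHub/Lines/SketchIdeator5R2.lean` posits, over tree
declarations only, so that its two transfer statements can be named in the ledger, plus the KERNEL-CHECKED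
FACTORISATION of the crux through them (`stub_legsGlue` / `squareFromVoronoiHub_of_legs`, sorry-free glue over the landed
assembly `CentreDecimation.stub_crux_of_voronoiToRandomDiagonal`).  No `Prop` is defined here; the two
transfer statements appear only as HYPOTHESES of the glue theorem (they are the crux's open universality
content, the route's foreseen layer-2 split "PoissonToJitteredSquare → JitteredSquareToRandomDiagonals →
DiagonalBiasToGs", the last being the landed centre-decimation identity).

The endpoint model of the product leg (card `Cruxes/SquareFromVoronoiHub/Ideas/one-product-leg.md`): the
annealed Voronoi colouring of the disc-jittered square lattice `ℤ² + ξ`, `ξ_v` i.i.d. uniform on the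
closed disc of radius `jitterRadius = 1/20`, colours i.i.d. fair; its Delaunay graph is `ℤ²` plus at
least one diagonal per face, king moves only, both diagonals only on concyclic faces (landed:
`ProductLeg.stub_jsdEdges`, `stub_jsdKing`, `stub_faceDiagonal`, `stub_crossingDelaunay_cospherical`).

Sources: the card; Benjamini–Schramm, Comm. Math. Phys. 197 (1998) §1 (conformal invariance conjecture for
Voronoi percolation); Bollobás–Riordan, *Percolation* (2006), Ch. 8 §8.1–8.2 (annealed Voronoi
percolation); L. T. Rolla, arXiv:1704.04930 §1 (the random-diagonal square lattice).
-/

noncomputable section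

open scoped Topology MeasureTheory
open Filter Set MeasureTheory Metric
open Literature.Analysis.FunctionSpaces (PointConfig IsPoissonPointProcess)
open Literature.Probability.RandomPlanarGeometry (ConformalRectangle cardyFunction)
open Literature.Probability.Percolation (SiteConfig sitePercolation half voronoiCrossing)
open Summit.CriticalPhenomena.CardyFormulaZ2.Cruxes.SquareFromVoronoiHub.VoronoiBlocks
  (voronoiCrossingProb)
open Summit.CriticalPhenomena.CardyFormulaZ2.Cruxes.SquareFromVoronoiHub.CentreDecimation
  (diagCrossingProb stub_crux_of_voronoiToRandomDiagonal)

namespace Summit.CriticalPhenomena.CardyFormulaZ2.Cruxes.SquareFromVoronoiHub.ProductLeg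

/-! ### The endpoint model of the product leg -/

/-- The jitter radius of the line, `1/20`: small enough that every face of the jittered lattice keeps a
Delaunay diagonal (`stub_faceDiagonal`) and below the card's bound `(1 - 1/√2)/2` for
`stub_jsdEdges` / `stub_jsdKing`. [folklore] -/
def jitterRadius : ℝ := 1 / 20

/-- The single-site jitter law: Lebesgue measure on `ℂ` conditioned on the closed disc of radius
`jitterRadius` (uniform on the disc; isotropic, so the annealed law of the jittered lattice is invariant
under the quarter turn and the reflections of `ℤ²`). [folklore] -/
def jitterLaw : Measure ℂ :=
  ProbabilityTheory.cond (volume : Measure ℂ) (closedBall (0 : ℂ) jitterRadius)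

/-- The jitter law is a probability measure (the disc has positive, finite area). [folklore] -/
instance isProbabilityMeasure_jitterLaw : IsProbabilityMeasure jitterLaw := by
  unfold jitterLaw
  refine ProbabilityTheory.cond_isProbabilityMeasure_of_finite ?_ ?_
  · exact (measure_closedBall_pos volume (0 : ℂ) (by norm_num [jitterRadius])).ne'
  · exact measure_closedBall_lt_top.ne

/-- Position of the square-lattice site `v ∈ ℤ²` in `ℂ` (the left summand of `VoronoiBlocks.zGs`).
[folklore] -/
def sqPos (v : ℤ × ℤ) : ℂ := (v.1 : ℂ) + (v.2 : ℂ) * Complex.I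

/-- The annealed law of the endpoint model: i.i.d. jitters `ξ_v ~ jitterLaw` (`Measure.infinitePi`)
and, independently, i.i.d. fair colours `σ ⊆ ℤ²` (the black sites). [cite: BollobasRiordan2006, Ch. 8 §8.1] -/
def jitteredLaw : Measure ((ℤ × ℤ → ℂ) × SiteConfig (ℤ × ℤ)) :=
  (Measure.infinitePi fun _ : ℤ × ℤ => jitterLaw).prod (sitePercolation (ℤ × ℤ) half)

/-- The nuclei of the jittered lattice carried by the site set `σ`: `{v + ξ v | v ∈ σ}` (black nuclei
for `σ`, white nuclei for `σᶜ`). [cite: BollobasRiordan2006, Ch. 8 §8.1] -/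
def jitterNuclei (ξ : ℤ × ℤ → ℂ) (σ : Set (ℤ × ℤ)) : Set ℂ :=
  (fun v => sqPos v + ξ v) '' σ

/-- The annealed continuum crossing probability of the conformal rectangle `R` at mesh `δ` for the
Voronoi colouring of the jittered lattice — the Literature event `voronoiCrossing` (black continuum path
in `closure Ω` from `(ab)` to `(cd)`, nuclei read at scale `δ`), exactly as in the crux's hypothesis
with the Poisson pair replaced by the jittered lattice. [cite: BollobasRiordan2006, Ch. 8 §8.2] -/
def jitteredCrossingProb (R : ConformalRectangle) (δ : ℝ) : ℝ :=
  jitteredLaw.real {p | voronoiCrossing R.carrier (R.arc 0) (R.arc 2) δ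
    (jitterNuclei p.1 p.2) (jitterNuclei p.1 p.2ᶜ)}

/-! ### The factorisation of the crux through the product leg and leg S -/

/-- **Factorisation (registered glue stub `stub_legsGlue`, kernel-checked, no sorry).**  If
(PoissonToJitteredSquare) Cardy's formula for annealed Poisson–Voronoi percolation implies Cardy's
formula for the annealed Voronoi colouring of the disc-jittered square lattice, and
(JitteredSquareToRandomDiagonals) the latter implies Cardy's formula for fair site percolation on `ℤ²`
with i.i.d. fair diagonals at the slacks `2δ` and `3δ`,
then the crux `CardyFlipRusso.SquareFromVoronoiHub` holds — through the landed centre-decimation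
assembly `stub_crux_of_voronoiToRandomDiagonal` (DiagonalBiasToGs).  Both hypotheses are OPEN
(universality transfers); this theorem records only that they are jointly sufficient BY NAME.
[cite: BenjaminiSchramm1998, §1] -/
theorem stub_legsGlue :
    ((∀ (PB PW : Measure (PointConfig ℂ)),
          IsPoissonPointProcess (volume : Measure ℂ) PB → IsPoissonPointProcess (volume : Measure ℂ) PW →
          ∀ R : ConformalRectangle, R.HasCrossingLimit (voronoiCrossingProb PB PW R) cardyFunction) →
        ∀ R : ConformalRectangle, R.HasCrossingLimit (jitteredCrossingProb R) cardyFunction) →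
      ((∀ R : ConformalRectangle, R.HasCrossingLimit (jitteredCrossingProb R) cardyFunction) →
          (∀ R : ConformalRectangle, R.HasCrossingLimit (diagCrossingProb R 2) cardyFunction) ∧
            (∀ R : ConformalRectangle, R.HasCrossingLimit (diagCrossingProb R 3) cardyFunction)) →
        Summit.CriticalPhenomena.CardyFormulaZ2.Theses.CardyFlipRusso.SquareFromVoronoiHub :=
  fun hP hS => stub_crux_of_voronoiToRandomDiagonal fun hV => hS (hP hV)

/-- The factorisation with named hypotheses (same content as `stub_legsGlue`). [cite: BenjaminiSchramm1998, §1] -/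
theorem squareFromVoronoiHub_of_legs
    (hP : (∀ (PB PW : Measure (PointConfig ℂ)),
          IsPoissonPointProcess (volume : Measure ℂ) PB → IsPoissonPointProcess (volume : Measure ℂ) PW →
          ∀ R : ConformalRectangle, R.HasCrossingLimit (voronoiCrossingProb PB PW R) cardyFunction) →
        ∀ R : ConformalRectangle, R.HasCrossingLimit (jitteredCrossingProb R) cardyFunction)
    (hS : (∀ R : ConformalRectangle, R.HasCrossingLimit (jitteredCrossingProb R) cardyFunction) →
        (∀ R : ConformalRectangle, R.HasCrossingLimit (diagCrossingProb R 2) cardyFunction) ∧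
          (∀ R : ConformalRectangle, R.HasCrossingLimit (diagCrossingProb R 3) cardyFunction)) :
    Summit.CriticalPhenomena.CardyFormulaZ2.Theses.CardyFlipRusso.SquareFromVoronoiHub :=
  stub_legsGlue hP hS

end Summit.CriticalPhenomena.CardyFormulaZ2.Cruxes.SquareFromVoronoiHub.ProductLeg

end
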